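import Summits.Ventures.PercRepro.GenQHypAddGen

/-!
# PercRepro — the SHARP «trace + X» functionals: the outside coloops counted exactly (night-4, gen 10)

`GenQHypAddGen` bounds the coloops of `B ∪ Y` by `m(B) + |Y|`; on the «hyperplane + 3 points» shapes that bound is
too weak to be true (numerics, sheet §64 (r): the crude functional is negative where the balance is far positive).
The exact accounting: a point of `Y` is a coloop of `B ∪ Y` iff removing it drops the rank (`ycol M B Y` counts
them), and a point of `B` can only be a coloop of `B ∪ Y` if it is one of `B` — so `m(B ∪ Y) ≤ m(B) + ycol M B Y`
(`mTr_union_le_add_ycol`; for the two-point families this is exactly the accounting of `hypAddTwoProfile`).  The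
sharp functionals `hypAddProfileS` / `traceHypAddProfileS` use that weight; `Jq_hyp_add_ge_profileS` /
`traceSum_hyp_add_ge_profileS` are the dominations.
-/
namespace PercRepro.GenQ

open Finset ThmH SixFour

variable {α : Type*} [DecidableEq α] {M : Matroid α} [M.Finite]

section HypAddGenSharp

variable {τ X : Finset α} {q t : ℕ}

/-- The points of `Y` that are coloops of `B ∪ Y`: `rk(B ∪ (Y ∖ y)) < rk(B ∪ Y)`. -/
noncomputable def ycol (M : Matroid α) [M.Finite] (B Y : Finset α) : ℕ :=
  (Y.filter (fun y => M.eRk ((B ∪ Y.erase y : Finset α) : Set α) < M.eRk ((B ∪ Y : Finset α) : Set α))).card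

/-- **The coloops of `B ∪ Y`, exactly on the `Y` side**: `m(B ∪ Y) ≤ m(B) + ycol M B Y` for disjoint `B, Y ⊆ E`. -/
theorem mTr_union_le_add_ycol {B Y : Finset α} (hdisj : Disjoint B Y) (hY : Y ⊆ gr M) :
    mTr M (B ∪ Y) ≤ mTr M B + ycol M B Y := by
  unfold mTr ycol
  refine (Finset.card_le_card ?_).trans (Finset.card_union_le _ _)
  intro x hx
  obtain ⟨hxBY, hxcl⟩ := mem_coloopsOf.1 hx
  rw [Finset.mem_union]
  rcases Finset.mem_union.1 hxBY with hxB | hxY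
  · left
    refine mem_coloopsOf.2 ⟨hxB, fun h => hxcl ?_⟩
    exact M.closure_subset_closure (Finset.coe_subset.2 (Finset.erase_subset_erase x Finset.subset_union_left)) h
  · right
    rw [Finset.mem_filter]
    refine ⟨hxY, ?_⟩
    have hxB : x ∉ B := Finset.disjoint_right.1 hdisj hxY
    have he : (B ∪ Y).erase x = B ∪ Y.erase x := by
      ext z
      simp only [Finset.mem_erase, Finset.mem_union]
      constructor
      · rintro ⟨hzx, hz | hz⟩
        · exact Or.inl hz
        · exact Or.inr ⟨hzx, hz⟩
      · rintro (hz | ⟨hzx, hz⟩)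
        · exact ⟨fun h => hxB (h ▸ hz), Or.inl hz⟩
        · exact ⟨hzx, Or.inr hz⟩
    rw [he] at hxcl
    have hxE : x ∈ M.E := by
      rw [← coe_gr M]
      exact_mod_cast hY hxY
    have hins : insert x (B ∪ Y.erase x) = B ∪ Y := by
      ext z
      simp only [Finset.mem_insert, Finset.mem_union, Finset.mem_erase]
      constructor
      · rintro (rfl | hz | ⟨_, hz⟩)
        · exact Or.inr hxY
        · exact Or.inl hz
        · exact Or.inr hz
      · rintro (hz | hz)
        · exact Or.inr (Or.inl hz)
        · by_cases hzx : z = x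
          · exact Or.inl hzx
          · exact Or.inr (Or.inr ⟨hzx, hz⟩)
    have hrk : M.eRk ((B ∪ Y : Finset α) : Set α) = M.eRk ((B ∪ Y.erase x : Finset α) : Set α) + 1 := by
      rw [← hins, Finset.coe_insert, Matroid.eRk_insert_eq_add_one ⟨hxE, hxcl⟩]
    rw [hrk]
    have hfin : M.eRk ((B ∪ Y.erase x : Finset α) : Set α) ≠ ⊤ :=
      (Matroid.RankFinite.isRkFinite (M := M) _).eRk_lt_top.ne
    exact ENat.lt_add_one_iff hfin |>.2 le_rfl

/-- **The sharp profile functional of the trace `τ` with the point set `X`** at level `q + 1`, type `t`: the weight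
`(q + 3 − t)/(1 + m(B) + ycol M B Y)` against the demand of `B ∪ Y` in `τ ∪ X`. -/
noncomputable def hypAddProfileS (M : Matroid α) [M.Finite] (τ X : Finset α) (q t : ℕ) : ℚ :=
  ∑ Y ∈ X.powerset, ∑ B ∈ liftSets M τ Y (q + 1),
    ((((q + 1 : ℕ) : ℚ) + 2 - t) * (1 / (1 + (mTr M B : ℚ) + ycol M B Y)) -
      ((((q + 1 : ℕ) : ℚ) + 2) / (((q + 1 : ℕ) : ℚ) + 1)) * dem M (τ ∪ X) t (B ∪ Y))

/-- **The balance of `τ ∪ X` at level `q + 1` dominates the sharp functional** (every type `t ≤ q + 1`, disjoint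
`τ`, `X ⊆ E`). -/
theorem Jq_hyp_add_ge_profileS (hdisj : Disjoint τ X) (hX : X ⊆ gr M) (ht : t ≤ q + 1) :
    hypAddProfileS M τ X q t ≤ Jq M (τ ∪ X) (q + 1) t := by
  rw [Jq_succ_eq_sum_hfun, Rq_union_eq_image_sigma τ X, Finset.sum_image (union_inj_on_sigma hdisj _),
    Finset.sum_sigma]
  unfold hypAddProfileS
  apply Finset.sum_le_sum
  intro Y hY
  apply Finset.sum_le_sum
  intro B hB
  rw [Finset.mem_powerset] at hY
  rw [mem_liftSets] at hB
  unfold hfun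
  apply sub_le_sub_right
  apply mul_le_mul_of_nonneg_left _ (coeff_nonneg ht)
  unfold wInf
  apply one_div_le_one_div_of_le (by positivity)
  have := mTr_union_le_add_ycol (M := M) (Finset.disjoint_of_subset_left hB.1 (Finset.disjoint_of_subset_right hY hdisj))
    (hY.trans hX)
  have h' : (mTr M (B ∪ Y) : ℚ) ≤ mTr M B + ycol M B Y := by exact_mod_cast this
  linarith

/-- **The sharp trace-layer functional**: the level-`(q + 2)` trace weights `(q + 4 − t)/(2 + m(B) + ycol M B Y)`. -/
noncomputable def traceHypAddProfileS (M : Matroid α) [M.Finite] (τ X : Finset α) (q t : ℕ) : ℚ :=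
  ∑ Y ∈ X.powerset, ∑ B ∈ liftSets M τ Y (q + 1),
    ((((q + 1 + 1 : ℕ) : ℚ) + 2 - t) * (1 / (2 + (mTr M B : ℚ) + ycol M B Y)) -
      ((((q + 1 + 1 : ℕ) : ℚ) + 2) / (((q + 1 + 1 : ℕ) : ℚ) + 1)) * dem M (τ ∪ X) t (B ∪ Y))

/-- **The level-`(q + 2)` trace sum of `τ ∪ X` dominates the sharp trace-layer functional** (every type `t ≤ q + 2`,
disjoint `τ`, `X ⊆ E`). -/
theorem traceSum_hyp_add_ge_profileS (hdisj : Disjoint τ X) (hX : X ⊆ gr M) (ht : t ≤ q + 2) :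
    traceHypAddProfileS M τ X q t ≤
      ∑ B ∈ Rq M (τ ∪ X) (q + 1),
        ((((q + 1 + 1 : ℕ) : ℚ) + 2 - t) * (1 / (2 + (mTr M B : ℚ))) -
          ((((q + 1 + 1 : ℕ) : ℚ) + 2) / (((q + 1 + 1 : ℕ) : ℚ) + 1)) * dem M (τ ∪ X) t B) := by
  rw [Rq_union_eq_image_sigma τ X, Finset.sum_image (union_inj_on_sigma hdisj _), Finset.sum_sigma]
  unfold traceHypAddProfileS
  apply Finset.sum_le_sum
  intro Y hY
  apply Finset.sum_le_sum
  intro B hB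
  rw [Finset.mem_powerset] at hY
  rw [mem_liftSets] at hB
  apply sub_le_sub_right
  apply mul_le_mul_of_nonneg_left _ (tcoeff_nonneg ht)
  apply one_div_le_one_div_of_le (by positivity)
  have := mTr_union_le_add_ycol (M := M) (Finset.disjoint_of_subset_left hB.1 (Finset.disjoint_of_subset_right hY hdisj))
    (hY.trans hX)
  have h' : (mTr M (B ∪ Y) : ℚ) ≤ mTr M B + ycol M B Y := by exact_mod_cast this
  linarith

end HypAddGenSharp

end PercRepro.GenQ
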